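import Summits.QuantumFields.BalabanUV.T4Continuum.Support.ShellMeasureWilsonSquareSchwarz
import Summits.QuantumFields.BalabanUV.T4Continuum.Support.ShellMeasureLandauWilsonSquaresPinned

/-!
# `T4Continuum.ShellMeasureLandauWilsonSquaresSchwarz` — row S85, file 2: THE WILSON SLOT OF END-II RE-FIRED THROUGH THE
# TWO-RADII (SCHWARZ) JUNCTION — S74 §4 ∕ f2 §2–§3 with the SECOND-ORDER budget and NO `1∕(r_Φ∕S − 1)`
(cell `pub-balaban`, sub-cell `t4`, spine estimate NE7c (node U5b); NE7c ROUND-2 crew, unit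
`b2b-balaban-t4-ne7c-formalise-leaf-09` gen 12 (the S74 lineage); owner table `t4/b2b-balaban-t4-ne7c-p1/LEAVES-NE7c-P1.md`
row **S85 f2** (owner ruling R-ne7cp1-g32-2 (b), journal l.17926; CLAIM l.17994); ADDITIVE — imports the owner's S85
`ShellMeasureWilsonSquareSchwarz` (p227893: `hE_of_wilsonPlaquettes_schwarz`) and this lineage's S74 f2
`ShellMeasureLandauWilsonSquaresPinned` (p226365∕p226646; hence S74 f1, the LD chain (A)∕(B)∕(E), leaf-07-g6's
`ShellMeasureLandauPinnedField` ∕ `…PinnedFixedPoint`) ONLY; every supplier consumed BY NAME; [folklore]; 0 `def`,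
0 `def … : Prop`, 0 sorry, 0 citation tags)

HONEST FRAMING.  Finite four-torus programme, rung (B)+1 only — NOT infinite volume, NOT a mass gap, NOT the Clay
problem, NOT summit progress; (B), `BetaPertHyp`, (B^μ) not consumed.  NE7c (`T4IndicatorShell.ShellWeightBound`) is
NOT PRINTED in [Balaban 1983–89] and NOT PROVED; «NE7c ⇐ the named binders» (trigger c3).  Nothing printed is asserted;
no estimate of Bałaban's is discharged; this is KERNEL PLUMBING carrying the owner's audit γ6 «COUPLING» (NOTE
N-ne7cp1-g32-1: the one-radius Wilson constant `3H̄∕(r_Φ∕S − 1)` is FIRST order in the window, `∝ p₀(g)∕g`; the two-radii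
constant is SECOND order, `∝ p₀(g)²`, the coupling CANCELS; NOT a K-uniformity failure) from S85's abstract letter-curve
END to the LD chain's chart rays, i.e. to the suppliers S80 ∕ S76 f2 actually consume.  Equation numbers LOCATE displayed
shapes only.  HONEST DEPENDENCY (cell): continuum YM on T⁴ ⇐ BetaPertH ∧ nine spine estimates (0/9 proved);
BetaPertH ⇐ (D1) ∧ (D4) ∧ CAP+tail; G-an2-4 gates asym, D1 and NE2/3/4.

WHAT IS PROVED ([folklore]; S74's binder lists VERBATIM except that the located number `S < r_Φ` is STRENGTHENED to
`2S ≤ r_Φ` — S85's inner radius `R₁ = 2` inside the analyticity radius `Rad = r_Φ∕S`; the typer's T-NE7c-11 records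
`7S < r_Φ` — and the budget binder is S85 §4's SECOND-ORDER shape `Σ_p |β|·(d_p + 2H_p∕(r_Φ∕S))·(2H_p∕(r_Φ∕S)) ≤ H̄`,
`2H_p∕(r_Φ∕S) = 2H_p·S∕r_Φ`; the CONCLUSION is END-II's `hE` with constant `3H̄` — no `1∕(r_Φ∕S − 1)`):
* §1 **`hE_landau_wilsonSquares_of_discBounds_schwarz`** — S74 f2 §2 (`…_of_discBounds`: letter ∕ curl bounds `a p`,
  `s₁ p` as BINDERS ON THE CURVE `Z_x σ` over the disc `‖σ‖ < r_Φ∕S`) re-concluded by ONE CALL of S85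
  `hE_of_wilsonPlaquettes_schwarz` in place of S74 §3 `hE_of_wilsonPlaquettes`; `H_p = s₁ p + expTail₂(m_w a p)`.
* §2 **`hE_landau_wilsonSquares_schwarz`** — S74 §4's FLAT chart-ray instance (`a p = κ_w p·z̄`, `s₁ p = κ_c p·z̄`,
  `z̄ = (ε₄+B₀b) + 4C₂B₀(ε₄+B₀b)²` by (B) `landauCurve_along`), from §1.
* §3 **`hE_landau_wilsonSquares_pinned_schwarz`** — S74 f2 §3's PINNED instance (readings `π𝒴, π𝒴′, π𝒳, πℬ`,
  leaf-07-g6's pinned chain binders VERBATIM, pinned read-out binders `‖ℓ Y‖ ≤ κ_w p‖π𝒴 Y‖`, `‖Σ_ℓ ℓ Y‖ ≤ κ_c p‖π𝒴 Y‖`,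
  `H_p` in `z_pin = B₁ₚbₚ∕((1 − q_W)(1 − L_C c_ι B_H))` by `norm_sub_landauField_chart_le`), from §1 — THE SUPPLIER the
  S80 twin (`ShellMeasureLandauEndRayStokesAssembledSchwarz`, this row's next file) fires in S76 f2's open Wilson slot.
S80's OWN budget binder `hsumw` CANNOT host the second-order constant: S80 hard-wires S74 f2 §3 at ONE radius (slot
constant `3H̄∕(r_Φ,w∕S − 1)`, first-order budget shape) — hence a 1-call twin over S76 f2, not an `H̄`-instantiation.
DISPLAYED, NOT DISCHARGED (c2): every chain binder, flat and pinned; `κ_w p`, `κ_c p` (the curl read-out norm — B11 (19)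
n = 1 ∕ (25) ∕ (37) TYPE, LOCATOR only); the skew∕real structure; `B_p`, `d_p`; the budget `H̄` (located in f3's twin).
NE7c NOT PROVED; spine PROVED 0∕9; NOTHING in the countdown moves.
-/

noncomputable section

open Set Metric NormedSpace
open scoped Matrix

namespace Summit.QuantumFields.BalabanUV.T4Continuum.ShellMeasureLandauWilsonSquaresSchwarz

open Literature.MathematicalPhysics.QuantumFieldTheory.Balaban1983to89
open B11Prop6Scheme (Prop4Hyp)
open T4ShellMeasurePlaquette (expTail₂ expTail₂_nonneg)
open Summit.QuantumFields.BalabanUV.T4Continuum.ShellMeasureWilsonWords (wordExp)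
open Summit.QuantumFields.BalabanUV.T4Continuum.ShellMeasureLandauExponent (currentData_zero)
open Summit.QuantumFields.BalabanUV.T4Continuum.ShellMeasureLandauHolonomy (solAt landauExp)
open Summit.QuantumFields.BalabanUV.T4Continuum.ShellMeasureLandauHolonomyChart (holOf holOf_apply cplx
  ofReal_smul_cplx rayData_chart smul_cplx_mem_ball)
open Summit.QuantumFields.BalabanUV.T4Continuum.ShellMeasureLandauHolonomyWeight (landauCurve_along)
open Summit.QuantumFields.BalabanUV.T4Continuum.ShellMeasureLandauHolonomyReal (landauField_mem_real)
open Summit.QuantumFields.BalabanUV.T4Continuum.ShellMeasureLandauPinnedFixedPoint (solAt_zero_zero landauExp_zero)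
open Summit.QuantumFields.BalabanUV.T4Continuum.ShellMeasureLandauPinnedField (norm_sub_landauField_chart_le)
open Summit.QuantumFields.BalabanUV.T4Continuum.ShellMeasureWilsonSquareSchwarz (hE_of_wilsonPlaquettes_schwarz)

section ChartRay

open scoped Matrix.Norms.L2Operator

variable {nM : Type*} [Fintype nM] [DecidableEq nM] [Nonempty nM]
variable {𝒴 𝒴' 𝒳 𝒵 ℬ : Type*} [NormedAddCommGroup 𝒴] [NormedSpace ℂ 𝒴] [CompleteSpace 𝒴]
  [NormedAddCommGroup 𝒴'] [NormedSpace ℂ 𝒴'] [NormedAddCommGroup 𝒳] [NormedSpace ℂ 𝒳] [CompleteSpace 𝒳]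
  [NormedAddCommGroup 𝒵] [NormedSpace ℂ 𝒵] [NormedAddCommGroup ℬ] [NormedSpace ℂ ℬ]
variable {n : ℕ} {𝒢 : 𝒵 →L[ℂ] 𝒴} {W𝒱 : 𝒴 → 𝒵} {B₀ C₄ a₃ : ℝ}

/-! ## §1 The core: S74 f2 §2 (letter bounds as binders on the curve) through S85's two-radii END -/

/-- **END-II's WILSON `hE` ON THE LD CHAIN'S CHART RAYS — TWO RADII, LETTER BOUNDS AS BINDERS ON THE CURVE.**  Exactly
the data of S74 f2 `hE_landau_wilsonSquares_of_discBounds` (the chain's point∕ray binders (P2) `h𝒢`, (P4) `hW`,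
(118)∕(121), (103) `hH₁`, (75) `hΦ…`, (44) `hCq`∕`hCd`, scaling `hι`, (46) `hH`, (54) `hq`∕`hRC`; weight read-outs `ℓw p`
of length `≤ m_w`; DISPLAYED per-plaquette bounds ON THE CURVE `Z_x σ = landauExp … (σ • cplx x)` over the disc
`‖σ‖ < r_Φ∕S`: `‖ℓ (Z_x σ)‖ ≤ a p`, `‖Σ_{ℓ∈ℓw p} ℓ (Z_x σ)‖ ≤ s₁ p`; the real structure with SKEW weight read-outs; frozen
unitary background plaquettes `B_p`, `‖B_p − 1‖ ≤ d_p`), with the located number STRENGTHENED to `2S ≤ r_Φ` (S85's inner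
radius `2 ≤ Rad = r_Φ∕S`) and the SECOND-ORDER budget `Σ_{p∈P_w} |β|(d_p + 2H_p∕(r_Φ∕S))(2H_p∕(r_Φ∕S)) ≤ H̄`,
`H_p = s₁ p + expTail₂(m_w a p)`.  CONCLUSION: END-II's `hE` for `𝓔_W y := Σ_{p∈P_w} β(1 − Re tr(B_p·holOf (ℓw p) Z y)∕N)`
with constant **`3H̄`** — S85 `hE_of_wilsonPlaquettes_schwarz` BY NAME on the letter curves `σ ↦ ℓ (Z_x σ)` (holomorphic
by (B) `landauCurve_along`, flat centre by `solAt_zero_zero`∕`landauExp_zero`, skew on `[0,1]` by (A)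
`landauField_mem_real`). [folklore] -/
theorem hE_landau_wilsonSquares_of_discBounds_schwarz {𝔭 : Type*} {W : Set (Fin n → ℝ)} {Pw : Finset 𝔭} {S : ℝ}
    (hS : 0 < S) (hWS : W ⊆ closedBall (0 : Fin n → ℝ) S)
    (h𝒢 : ∀ f, ‖𝒢 f‖ ≤ B₀ * ‖f‖) (hW : Prop4Hyp W𝒱 C₄ a₃) (hB₀ : 0 < B₀) (hC₄ : 0 ≤ C₄)
    {b ε₄ : ℝ} (hε₄ : 0 ≤ ε₄) (hdom : 2 * (ε₄ + B₀ * b) ≤ a₃)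
    (hself : B₀ * C₄ * (ε₄ + B₀ * b) ^ 2 ≤ ε₄) (hcontr : 4 * B₀ * C₄ * (ε₄ + B₀ * b) < 1)
    (H₁ : ℬ →L[ℂ] 𝒴) (hH₁ : ∀ B, ‖H₁ B‖ ≤ B₀ * ‖B‖)
    {Φ : (Fin n → ℂ) → ℬ} {rΦ : ℝ} (hΦd : DifferentiableOn ℂ Φ (ball 0 rΦ)) (hΦ0 : Φ 0 = 0)
    (hΦ : ∀ z ∈ ball (0 : Fin n → ℂ) rΦ, ‖Φ z‖ < b) (h2S : 2 * S ≤ rΦ)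
    {C : 𝒴' → 𝒳} {C₂ R : ℝ} (hC₂ : 0 ≤ C₂) (hCq : ∀ Z : 𝒴', ‖Z‖ < R → ‖C Z‖ ≤ C₂ * ‖Z‖ ^ 2)
    (hCd : DifferentiableOn ℂ C (ball 0 R)) (ι : 𝒴 →L[ℂ] 𝒴') (hι : ∀ Y, ‖ι Y‖ ≤ ‖Y‖) (H : 𝒳 →L[ℂ] 𝒴)
    (hH : ∀ X, ‖H X‖ ≤ B₀ * ‖X‖) (hq : 9 * C₂ * B₀ * (ε₄ + B₀ * b) < 1) (hRC : 3 * (ε₄ + B₀ * b) ≤ R)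
    -- weight read-outs, lengths, and the letter ∕ curl bounds ON THE CURVE (DISPLAYED)
    (ℓw : 𝔭 → List (𝒴 →L[ℂ] Matrix nM nM ℂ)) {mw : ℕ} (hlenw : ∀ p ∈ Pw, (ℓw p).length ≤ mw) {a s₁ : 𝔭 → ℝ}
    (ha0 : ∀ p ∈ Pw, 0 ≤ a p)
    (hZℓ : ∀ x ∈ W, ∀ σ ∈ ball (0 : ℂ) (rΦ / S), ∀ p ∈ Pw, ∀ ℓ ∈ ℓw p,
      ‖ℓ (landauExp C ι H (4 * C₂ * (ε₄ + B₀ * b) ^ 2)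
        (solAt 𝒢 0 W𝒱 ε₄ (0 : 𝒵) (H₁ (Φ (σ • cplx x))) + H₁ (Φ (σ • cplx x))))‖ ≤ a p)
    (hZcurl : ∀ x ∈ W, ∀ σ ∈ ball (0 : ℂ) (rΦ / S), ∀ p ∈ Pw,
      ‖((ℓw p).map fun ℓ => ℓ (landauExp C ι H (4 * C₂ * (ε₄ + B₀ * b) ^ 2)
        (solAt 𝒢 0 W𝒱 ε₄ (0 : 𝒵) (H₁ (Φ (σ • cplx x))) + H₁ (Φ (σ • cplx x))))).sum‖ ≤ s₁ p)
    -- the real structure (chain (A)) with SKEW weight read-outs (chain (E))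
    (𝓡𝒴 : AddSubgroup 𝒴) (h𝓡𝒴 : IsClosed (𝓡𝒴 : Set 𝒴)) (𝓡𝒵 : AddSubgroup 𝒵) (𝓡𝒴' : AddSubgroup 𝒴')
    (𝓡𝒳 : AddSubgroup 𝒳) (h𝓡𝒳 : IsClosed (𝓡𝒳 : Set 𝒳)) (𝓡ℬ : AddSubgroup ℬ)
    (h𝒢r : ∀ f ∈ 𝓡𝒵, 𝒢 f ∈ 𝓡𝒴) (hWr : ∀ Y ∈ 𝓡𝒴, W𝒱 Y ∈ 𝓡𝒵) (hιr : ∀ Y ∈ 𝓡𝒴, ι Y ∈ 𝓡𝒴')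
    (hHr : ∀ X ∈ 𝓡𝒳, H X ∈ 𝓡𝒴) (hCr : ∀ Z ∈ 𝓡𝒴', C Z ∈ 𝓡𝒳) (hH₁r : ∀ B ∈ 𝓡ℬ, H₁ B ∈ 𝓡𝒴)
    (hΦr : ∀ y : Fin n → ℝ, ‖y‖ ≤ S → Φ (cplx y) ∈ 𝓡ℬ)
    (hskew : ∀ p ∈ Pw, ∀ ℓ ∈ ℓw p, ∀ Y ∈ 𝓡𝒴, ℓ Y ∈ skewAdjoint (Matrix nM nM ℂ))
    -- the frozen background plaquettes (N-ne7cp1-g31-2): unitary, `‖B_p − 1‖ ≤ d_p` (DISPLAYED)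
    (Bp : 𝔭 → Matrix nM nM ℂ) {d : 𝔭 → ℝ} (hBu : ∀ p ∈ Pw, Bp p ∈ unitary (Matrix nM nM ℂ))
    (hBd : ∀ p ∈ Pw, ‖Bp p - 1‖ ≤ d p)
    -- the budget, SECOND ORDER in the window (S85): `2H_p∕(r_Φ∕S) = 2H_p·S∕r_Φ`
    {β Hbar : ℝ}
    (hsum : ∑ p ∈ Pw, |β| * (d p + 2 * (s₁ p + expTail₂ (mw * a p)) / (rΦ / S)) *
      (2 * (s₁ p + expTail₂ (mw * a p)) / (rΦ / S)) ≤ Hbar) :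
    ∀ x ∈ W, ∀ c : ℝ, 1 / 2 ≤ c → c ≤ 1 →
      (fun y => ∑ p ∈ Pw, β * (1 - (Matrix.trace (Bp p * holOf (ℓw p) (fun y => landauExp C ι H
        (4 * C₂ * (ε₄ + B₀ * b) ^ 2) (solAt 𝒢 0 W𝒱 ε₄ (0 : 𝒵) (H₁ (Φ (cplx y))) + H₁ (Φ (cplx y)))) y)).re /
          Fintype.card nM)) (c • x) ≤
      (fun y => ∑ p ∈ Pw, β * (1 - (Matrix.trace (Bp p * holOf (ℓw p) (fun y => landauExp C ι H
        (4 * C₂ * (ε₄ + B₀ * b) ^ 2) (solAt 𝒢 0 W𝒱 ε₄ (0 : 𝒵) (H₁ (Φ (cplx y))) + H₁ (Φ (cplx y)))) y)).re /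
          Fintype.card nM)) x +
        (1 - c) * (3 * Hbar) := by
  -- the chain's curve along the chart ray
  set Zc : (Fin n → ℝ) → ℂ → 𝒴 := fun x σ =>
    landauExp C ι H (4 * C₂ * (ε₄ + B₀ * b) ^ 2)
      (solAt 𝒢 0 W𝒱 ε₄ (0 : 𝒵) (H₁ (Φ (σ • cplx x))) + H₁ (Φ (σ • cplx x))) with hZc
  have hSr : S < rΦ := by linarith
  have hRad2 : 2 ≤ rΦ / S := by rw [le_div_iff₀ hS]; linarith
  have hRad : 0 < rΦ / S := two_pos.trans_le hRad2
  have hb : 0 < b := (norm_nonneg _).trans_lt (hΦ 0 (mem_ball_self (hS.trans hSr)))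
  have ha : 0 < B₀ * b := mul_pos hB₀ hb
  have hΛ : ∀ Y : 𝒴, ‖(0 : 𝒴 →L[ℂ] 𝒴) Y‖ ≤ 0 * ‖Y‖ := fun Y => by simp
  have hself' : B₀ * 0 + 0 * (ε₄ + B₀ * b) + B₀ * C₄ * (ε₄ + B₀ * b) ^ 2 ≤ ε₄ := by simpa using hself
  have hcontr' : 0 + 4 * B₀ * C₄ * (ε₄ + B₀ * b) < 1 := by simpa using hcontr
  have hray := fun x (hx : x ∈ W) =>
    rayData_chart H₁ hH₁ hB₀ hΦd hΦ0 hΦ hS (mem_closedBall_zero_iff.1 (hWS hx))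
  have hcurve : ∀ x ∈ W, DifferentiableOn ℂ (Zc x) (ball 0 (rΦ / S)) := fun x hx =>
    (landauCurve_along h𝒢 hΛ hW hB₀.le hC₄ le_rfl hε₄ hdom hself' hcontr' hRad
      (currentData_zero (𝒵 := 𝒵) (rΦ / S)).1 (hray x hx).1 (currentData_zero (𝒵 := 𝒵) (rΦ / S)).2.1
      (hray x hx).2.2.1 rfl (hray x hx).2.1 hC₂ hCq hCd ι hι H hH hq hRC).1
  -- the flat centre: `Zc x 0 = 0`
  have hε4a : 0 < ε₄ + B₀ * b := by linarith
  have hZ0 : ∀ x, Zc x 0 = 0 := fun x => by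
    simp only [hZc, zero_smul, hΦ0, map_zero]
    rw [solAt_zero_zero h𝒢 hΛ hW hB₀.le hC₄ le_rfl hε₄ ha hdom hself' hcontr', zero_add]
    exact landauExp_zero hC₂ hCq hCd hι hB₀.le hH hq hRC hε4a
  -- real chart points of the window: the exponent field is real, the weight letters skew
  have hreal : ∀ x ∈ W, ∀ c : ℝ, 0 ≤ c → c ≤ 1 → ∀ p ∈ Pw, ∀ ℓ ∈ ℓw p,
      ℓ (Zc x (c : ℂ)) ∈ skewAdjoint (Matrix nM nM ℂ) := by
    intro x hx c hc0 hc1 p hp ℓ hℓ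
    have hy : ‖c • x‖ ≤ S := by
      rw [norm_smul, Real.norm_of_nonneg hc0]
      exact (mul_le_of_le_one_left (norm_nonneg _) hc1).trans (mem_closedBall_zero_iff.1 (hWS hx))
    have hmem := landauField_mem_real h𝒢 hW hB₀ hC₄ hε₄ hdom hself hcontr H₁ hH₁ hΦ hSr hC₂ hCq hCd ι hι H hH hq hRC
      𝓡𝒴 h𝓡𝒴 𝓡𝒵 𝓡𝒴' 𝓡𝒳 h𝓡𝒳 𝓡ℬ h𝒢r hWr hιr hHr hCr hH₁r hΦr hy
    have e : Zc x (c : ℂ) = landauExp C ι H (4 * C₂ * (ε₄ + B₀ * b) ^ 2)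
        (solAt 𝒢 0 W𝒱 ε₄ (0 : 𝒵) (H₁ (Φ (cplx (c • x)))) + H₁ (Φ (cplx (c • x)))) := by
      simp only [hZc, ofReal_smul_cplx]
    rw [e]
    exact hskew p hp ℓ hℓ _ hmem
  -- S85 §4 on the letter curves `σ ↦ ℓ (Zc x σ)`, big disc `Rad = r_Φ∕S ≥ 2`
  refine hE_of_wilsonPlaquettes_schwarz (fun _ => Pw) (fun _ p => Bp p)
    (fun x p => (ℓw p).map fun ℓ => fun σ => ℓ (Zc x σ))
    (Rad := rΦ / S) (β := β) (Hbar := Hbar) (d := fun _ p => d p) (a := fun _ p => a p)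
    (s₁ := fun _ p => s₁ p) (m := mw) hRad2 (fun x _ p hp => hBu p hp) (fun x _ p hp => hBd p hp)
    (fun x _ p hp => by simpa using hlenw p hp) (fun x hx p hp X hX => ?_) (fun x hx p hp X hX => ?_)
    (fun x _ p hp => ha0 p hp) (fun x hx p hp X hX w hw => ?_) (fun x hx p hp w hw => ?_)
    (fun x hx p hp c hc0 hc1 X hX => ?_) (fun x _ => hsum)
    (𝓔 := fun y => ∑ p ∈ Pw, β * (1 - (Matrix.trace (Bp p * holOf (ℓw p) (fun y => landauExp C ι H
        (4 * C₂ * (ε₄ + B₀ * b) ^ 2) (solAt 𝒢 0 W𝒱 ε₄ (0 : 𝒵) (H₁ (Φ (cplx y))) + H₁ (Φ (cplx y)))) y)).re /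
          Fintype.card nM))
    (fun x hx c hc0 hc1 => ?_)
  · -- holomorphy of a letter curve
    obtain ⟨ℓ, -, rfl⟩ := List.mem_map.1 hX
    exact ℓ.differentiable.comp_differentiableOn (hcurve x hx)
  · -- vanishing at the flat centre
    obtain ⟨ℓ, -, rfl⟩ := List.mem_map.1 hX
    simp [hZ0 x]
  · -- per-letter bound (the binder on the curve)
    obtain ⟨ℓ, hℓ, rfl⟩ := List.mem_map.1 hX
    exact hZℓ x hx w hw p hp ℓ hℓ
  · -- the curl bound (the binder on the curve)
    have e : ((((ℓw p).map fun ℓ => fun σ => ℓ (Zc x σ)).map fun X => X w)) = (ℓw p).map fun ℓ => ℓ (Zc x w) := by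
      rw [List.map_map]; rfl
    rw [e]
    exact hZcurl x hx w hw p hp
  · -- skew letters on the real segment
    obtain ⟨ℓ, hℓ, rfl⟩ := List.mem_map.1 hX
    exact hreal x hx c hc0 hc1 p hp ℓ hℓ
  · -- the dictionary
    refine Finset.sum_congr rfl fun p _ => ?_
    have e : ((((ℓw p).map fun ℓ => fun σ => ℓ (Zc x σ)).map fun X => X (c : ℂ)).map exp).prod =
        holOf (ℓw p) (fun y => landauExp C ι H (4 * C₂ * (ε₄ + B₀ * b) ^ 2)
          (solAt 𝒢 0 W𝒱 ε₄ (0 : 𝒵) (H₁ (Φ (cplx y))) + H₁ (Φ (cplx y)))) (c • x) := by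
      simp only [holOf_apply, wordExp, List.map_map, Function.comp_def, hZc, ofReal_smul_cplx]
    rw [e]

/-! ## §2 The flat chart-ray instance (S74 §4), two radii -/

/-- **END-II's WILSON `hE` ON THE LD CHAIN'S CHART RAYS — TWO RADII, FLAT READ-OUT BINDERS** (S74 §4
`hE_landau_wilsonSquares` re-fired through S85).  Data: S74 §4's VERBATIM — the chain's point∕ray binders, weight
read-outs `ℓw p` with per-plaquette op-norm constants `‖ℓ Y‖ ≤ κ_w p‖Y‖` and the CURL read-out norm
`‖Σ_{ℓ∈ℓw p} ℓ Y‖ ≤ κ_c p‖Y‖` (F-ne7cp1-g31-1 (A), DISPLAYED), lengths `≤ m_w`, the real structure with SKEW weight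
read-outs, frozen unitary `B_p` with `‖B_p − 1‖ ≤ d_p` — with `2S ≤ r_Φ` and the SECOND-ORDER budget
`Σ_{p∈P_w} |β|(d_p + 2H_p∕(r_Φ∕S))(2H_p∕(r_Φ∕S)) ≤ H̄`, `H_p = κ_c p·z̄ + expTail₂(m_w κ_w p z̄)`,
`z̄ = (ε₄+B₀b) + 4C₂B₀(ε₄+B₀b)²`.  CONCLUSION: END-II's `hE` for the DEFINED Wilson ray profile `𝓔_W` with constant
**`3H̄`** (§1 with `a p := κ_w p·z̄`, `s₁ p := κ_c p·z̄`, the curve's flat size by (B) `landauCurve_along`). [folklore] -/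
theorem hE_landau_wilsonSquares_schwarz {𝔭 : Type*} {W : Set (Fin n → ℝ)} {Pw : Finset 𝔭} {S : ℝ}
    (hS : 0 < S) (hWS : W ⊆ closedBall (0 : Fin n → ℝ) S)
    (h𝒢 : ∀ f, ‖𝒢 f‖ ≤ B₀ * ‖f‖) (hW : Prop4Hyp W𝒱 C₄ a₃) (hB₀ : 0 < B₀) (hC₄ : 0 ≤ C₄)
    {b ε₄ : ℝ} (hε₄ : 0 ≤ ε₄) (hdom : 2 * (ε₄ + B₀ * b) ≤ a₃)
    (hself : B₀ * C₄ * (ε₄ + B₀ * b) ^ 2 ≤ ε₄) (hcontr : 4 * B₀ * C₄ * (ε₄ + B₀ * b) < 1)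
    (H₁ : ℬ →L[ℂ] 𝒴) (hH₁ : ∀ B, ‖H₁ B‖ ≤ B₀ * ‖B‖)
    {Φ : (Fin n → ℂ) → ℬ} {rΦ : ℝ} (hΦd : DifferentiableOn ℂ Φ (ball 0 rΦ)) (hΦ0 : Φ 0 = 0)
    (hΦ : ∀ z ∈ ball (0 : Fin n → ℂ) rΦ, ‖Φ z‖ < b) (h2S : 2 * S ≤ rΦ)
    {C : 𝒴' → 𝒳} {C₂ R : ℝ} (hC₂ : 0 ≤ C₂) (hCq : ∀ Z : 𝒴', ‖Z‖ < R → ‖C Z‖ ≤ C₂ * ‖Z‖ ^ 2)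
    (hCd : DifferentiableOn ℂ C (ball 0 R)) (ι : 𝒴 →L[ℂ] 𝒴') (hι : ∀ Y, ‖ι Y‖ ≤ ‖Y‖) (H : 𝒳 →L[ℂ] 𝒴)
    (hH : ∀ X, ‖H X‖ ≤ B₀ * ‖X‖) (hq : 9 * C₂ * B₀ * (ε₄ + B₀ * b) < 1) (hRC : 3 * (ε₄ + B₀ * b) ≤ R)
    -- weight read-outs: per-plaquette letter norms AND the curl read-out norm (DISPLAYED), lengths
    (ℓw : 𝔭 → List (𝒴 →L[ℂ] Matrix nM nM ℂ)) {κw κc : 𝔭 → ℝ} (hκw : ∀ p ∈ Pw, 0 ≤ κw p)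
    (hκc : ∀ p ∈ Pw, 0 ≤ κc p)
    (hℓw : ∀ p ∈ Pw, ∀ ℓ ∈ ℓw p, ∀ Y, ‖ℓ Y‖ ≤ κw p * ‖Y‖)
    (hcurl : ∀ p ∈ Pw, ∀ Y, ‖((ℓw p).map fun ℓ => ℓ Y).sum‖ ≤ κc p * ‖Y‖)
    {mw : ℕ} (hlenw : ∀ p ∈ Pw, (ℓw p).length ≤ mw)
    -- the real structure (chain (A)) with SKEW weight read-outs (chain (E))
    (𝓡𝒴 : AddSubgroup 𝒴) (h𝓡𝒴 : IsClosed (𝓡𝒴 : Set 𝒴)) (𝓡𝒵 : AddSubgroup 𝒵) (𝓡𝒴' : AddSubgroup 𝒴')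
    (𝓡𝒳 : AddSubgroup 𝒳) (h𝓡𝒳 : IsClosed (𝓡𝒳 : Set 𝒳)) (𝓡ℬ : AddSubgroup ℬ)
    (h𝒢r : ∀ f ∈ 𝓡𝒵, 𝒢 f ∈ 𝓡𝒴) (hWr : ∀ Y ∈ 𝓡𝒴, W𝒱 Y ∈ 𝓡𝒵) (hιr : ∀ Y ∈ 𝓡𝒴, ι Y ∈ 𝓡𝒴')
    (hHr : ∀ X ∈ 𝓡𝒳, H X ∈ 𝓡𝒴) (hCr : ∀ Z ∈ 𝓡𝒴', C Z ∈ 𝓡𝒳) (hH₁r : ∀ B ∈ 𝓡ℬ, H₁ B ∈ 𝓡𝒴)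
    (hΦr : ∀ y : Fin n → ℝ, ‖y‖ ≤ S → Φ (cplx y) ∈ 𝓡ℬ)
    (hskew : ∀ p ∈ Pw, ∀ ℓ ∈ ℓw p, ∀ Y ∈ 𝓡𝒴, ℓ Y ∈ skewAdjoint (Matrix nM nM ℂ))
    -- the frozen background plaquettes at the chart centre (N-ne7cp1-g31-2): unitary, `‖B_p − 1‖ ≤ d_p` (DISPLAYED)
    (Bp : 𝔭 → Matrix nM nM ℂ) {d : 𝔭 → ℝ} (hBu : ∀ p ∈ Pw, Bp p ∈ unitary (Matrix nM nM ℂ))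
    (hBd : ∀ p ∈ Pw, ‖Bp p - 1‖ ≤ d p)
    -- the budget, SECOND ORDER in the window (S85)
    {β Hbar : ℝ}
    (hsum : ∑ p ∈ Pw, |β| * (d p + 2 * (κc p * ((ε₄ + B₀ * b) + B₀ * (4 * C₂ * (ε₄ + B₀ * b) ^ 2)) +
        expTail₂ (mw * (κw p * ((ε₄ + B₀ * b) + B₀ * (4 * C₂ * (ε₄ + B₀ * b) ^ 2))))) / (rΦ / S)) *
      (2 * (κc p * ((ε₄ + B₀ * b) + B₀ * (4 * C₂ * (ε₄ + B₀ * b) ^ 2)) +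
        expTail₂ (mw * (κw p * ((ε₄ + B₀ * b) + B₀ * (4 * C₂ * (ε₄ + B₀ * b) ^ 2))))) / (rΦ / S)) ≤ Hbar) :
    ∀ x ∈ W, ∀ c : ℝ, 1 / 2 ≤ c → c ≤ 1 →
      (fun y => ∑ p ∈ Pw, β * (1 - (Matrix.trace (Bp p * holOf (ℓw p) (fun y => landauExp C ι H
        (4 * C₂ * (ε₄ + B₀ * b) ^ 2) (solAt 𝒢 0 W𝒱 ε₄ (0 : 𝒵) (H₁ (Φ (cplx y))) + H₁ (Φ (cplx y)))) y)).re /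
          Fintype.card nM)) (c • x) ≤
      (fun y => ∑ p ∈ Pw, β * (1 - (Matrix.trace (Bp p * holOf (ℓw p) (fun y => landauExp C ι H
        (4 * C₂ * (ε₄ + B₀ * b) ^ 2) (solAt 𝒢 0 W𝒱 ε₄ (0 : 𝒵) (H₁ (Φ (cplx y))) + H₁ (Φ (cplx y)))) y)).re /
          Fintype.card nM)) x +
        (1 - c) * (3 * Hbar) := by
  set zbar : ℝ := (ε₄ + B₀ * b) + B₀ * (4 * C₂ * (ε₄ + B₀ * b) ^ 2) with hzbar
  have hSr : S < rΦ := by linarith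
  have hRad : 0 < rΦ / S := div_pos (hS.trans hSr) hS
  have hz : 0 ≤ zbar := by
    have hb : 0 < b := (norm_nonneg _).trans_lt (hΦ 0 (mem_ball_self (hS.trans hSr)))
    rw [hzbar]; positivity
  have hΛ : ∀ Y : 𝒴, ‖(0 : 𝒴 →L[ℂ] 𝒴) Y‖ ≤ 0 * ‖Y‖ := fun Y => by simp
  have hself' : B₀ * 0 + 0 * (ε₄ + B₀ * b) + B₀ * C₄ * (ε₄ + B₀ * b) ^ 2 ≤ ε₄ := by simpa using hself
  have hcontr' : 0 + 4 * B₀ * C₄ * (ε₄ + B₀ * b) < 1 := by simpa using hcontr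
  have hray := fun x (hx : x ∈ W) =>
    rayData_chart H₁ hH₁ hB₀ hΦd hΦ0 hΦ hS (mem_closedBall_zero_iff.1 (hWS hx))
  -- the curve's FLAT size on the disc: (B) `landauCurve_along`
  have hcurve : ∀ x ∈ W, ∀ σ ∈ ball (0 : ℂ) (rΦ / S), ‖landauExp C ι H (4 * C₂ * (ε₄ + B₀ * b) ^ 2)
      (solAt 𝒢 0 W𝒱 ε₄ (0 : 𝒵) (H₁ (Φ (σ • cplx x))) + H₁ (Φ (σ • cplx x)))‖ ≤ zbar := fun x hx =>
    (landauCurve_along h𝒢 hΛ hW hB₀.le hC₄ le_rfl hε₄ hdom hself' hcontr' hRad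
      (currentData_zero (𝒵 := 𝒵) (rΦ / S)).1 (hray x hx).1 (currentData_zero (𝒵 := 𝒵) (rΦ / S)).2.1
      (hray x hx).2.2.1 rfl (hray x hx).2.1 hC₂ hCq hCd ι hι H hH hq hRC).2
  refine hE_landau_wilsonSquares_of_discBounds_schwarz hS hWS h𝒢 hW hB₀ hC₄ hε₄ hdom hself hcontr H₁ hH₁ hΦd hΦ0
    hΦ h2S hC₂ hCq hCd ι hι H hH hq hRC ℓw hlenw (a := fun p => κw p * zbar) (s₁ := fun p => κc p * zbar)
    (fun p hp => mul_nonneg (hκw p hp) hz) (fun x hx σ hσ p hp ℓ hℓ => ?_) (fun x hx σ hσ p hp => ?_)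
    𝓡𝒴 h𝓡𝒴 𝓡𝒵 𝓡𝒴' 𝓡𝒳 h𝓡𝒳 𝓡ℬ h𝒢r hWr hιr hHr hCr hH₁r hΦr hskew Bp hBu hBd (by simpa [hzbar] using hsum)
  · exact (hℓw p hp ℓ hℓ _).trans (mul_le_mul_of_nonneg_left (hcurve x hx σ hσ) (hκw p hp))
  · exact (hcurl p hp _).trans (mul_le_mul_of_nonneg_left (hcurve x hx σ hσ) (hκc p hp))

/-! ## §3 The pinned instance (S74 f2 §3), two radii — the S80 twin's Wilson supplier -/

variable {P𝒴 P𝒴' P𝒳 Pℬ : Type*} [NormedAddCommGroup P𝒴] [NormedSpace ℂ P𝒴] [NormedAddCommGroup P𝒴']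
  [NormedSpace ℂ P𝒴'] [NormedAddCommGroup P𝒳] [NormedSpace ℂ P𝒳] [NormedAddCommGroup Pℬ] [NormedSpace ℂ Pℬ]

/-- **END-II's WILSON `hE` FOR THE FAR (AND NEAR) WEIGHT PLAQUETTES, PINNED — TWO RADII** (S74 f2 §3
`hE_landau_wilsonSquares_pinned` re-fired through S85).  Data: S74 f2 §3's VERBATIM — the flat chain binders; the reading
`π𝒴, π𝒴′, π𝒳, πℬ` with leaf-07-g6's PINNED chain binders (`hGWp` with `q_W < 1`, `hCp`, `hιp`, `hHp` with
`k = L_C c_ι B_H < 1`, `hH₁p`, `hΦp` on the chart ball); PINNED read-out binders `‖ℓ Y‖ ≤ κ_w p‖π𝒴 Y‖` and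
`‖Σ_{ℓ∈ℓw p} ℓ Y‖ ≤ κ_c p‖π𝒴 Y‖` (S69 (B)'s output shape); lengths; the real structure with SKEW weight read-outs; `B_p`,
`d_p` — with `2S ≤ r_Φ` and the SECOND-ORDER budget `Σ_{p∈P_w} |β|(d_p + 2H_p∕(r_Φ∕S))(2H_p∕(r_Φ∕S)) ≤ H̄`,
`H_p = κ_c p·z_pin + expTail₂(m_w κ_w p z_pin)`, **`z_pin = B₁ₚbₚ∕((1 − q_W)(1 − L_C c_ι B_H))`**.  CONCLUSION: END-II's
`hE` for `𝓔_W` with constant **`3H̄`** (§1 with `a p = κ_w p·z_pin`, `s₁ p = κ_c p·z_pin`, the curve's pinned size by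
`ShellMeasureLandauPinnedField.norm_sub_landauField_chart_le` on the complex chart ray). [folklore] -/
theorem hE_landau_wilsonSquares_pinned_schwarz {𝔭 : Type*} {W : Set (Fin n → ℝ)} {Pw : Finset 𝔭} {S : ℝ}
    (hS : 0 < S) (hWS : W ⊆ closedBall (0 : Fin n → ℝ) S)
    (h𝒢 : ∀ f, ‖𝒢 f‖ ≤ B₀ * ‖f‖) (hW : Prop4Hyp W𝒱 C₄ a₃) (hB₀ : 0 < B₀) (hC₄ : 0 ≤ C₄)
    {b ε₄ : ℝ} (hε₄ : 0 ≤ ε₄) (hdom : 2 * (ε₄ + B₀ * b) ≤ a₃)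
    (hself : B₀ * C₄ * (ε₄ + B₀ * b) ^ 2 ≤ ε₄) (hcontr : 4 * B₀ * C₄ * (ε₄ + B₀ * b) < 1)
    (H₁ : ℬ →L[ℂ] 𝒴) (hH₁ : ∀ B, ‖H₁ B‖ ≤ B₀ * ‖B‖)
    {Φ : (Fin n → ℂ) → ℬ} {rΦ : ℝ} (hΦd : DifferentiableOn ℂ Φ (ball 0 rΦ)) (hΦ0 : Φ 0 = 0)
    (hΦ : ∀ z ∈ ball (0 : Fin n → ℂ) rΦ, ‖Φ z‖ < b) (h2S : 2 * S ≤ rΦ)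
    {C : 𝒴' → 𝒳} {C₂ R : ℝ} (hC₂ : 0 ≤ C₂) (hCq : ∀ Z : 𝒴', ‖Z‖ < R → ‖C Z‖ ≤ C₂ * ‖Z‖ ^ 2)
    (hCd : DifferentiableOn ℂ C (ball 0 R)) (ι : 𝒴 →L[ℂ] 𝒴') (hι : ∀ Y, ‖ι Y‖ ≤ ‖Y‖) (H : 𝒳 →L[ℂ] 𝒴)
    (hH : ∀ X, ‖H X‖ ≤ B₀ * ‖X‖) (hq : 9 * C₂ * B₀ * (ε₄ + B₀ * b) < 1) (hRC : 3 * (ε₄ + B₀ * b) ≤ R)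
    -- the reading and leaf-07's pinned chain binders (DISPLAYED)
    (π𝒴 : 𝒴 →L[ℂ] P𝒴) (π𝒴' : 𝒴' →L[ℂ] P𝒴') (π𝒳 : 𝒳 →L[ℂ] P𝒳) (πℬ : ℬ →L[ℂ] Pℬ) {qW LC cι BH B₁p bp : ℝ}
    (hGWp : ∀ Y Y', ‖Y‖ < ε₄ + B₀ * b → ‖Y'‖ < ε₄ + B₀ * b →
      ‖π𝒴 (𝒢 (W𝒱 Y)) - π𝒴 (𝒢 (W𝒱 Y'))‖ ≤ qW * ‖π𝒴 Y - π𝒴 Y'‖) (hqW : qW < 1)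
    (hCp : ∀ A A' : 𝒴', ‖A‖ < R → ‖A'‖ < R → ‖π𝒳 (C A) - π𝒳 (C A')‖ ≤ LC * ‖π𝒴' A - π𝒴' A'‖)
    (hιp : ∀ Y, ‖π𝒴' (ι Y)‖ ≤ cι * ‖π𝒴 Y‖) (hHp : ∀ X, ‖π𝒴 (H X)‖ ≤ BH * ‖π𝒳 X‖)
    (hLC : 0 ≤ LC) (hcι : 0 ≤ cι) (hBH : 0 ≤ BH) (hk : LC * cι * BH < 1)
    (hB₁p : 0 ≤ B₁p) (hH₁p : ∀ B, ‖π𝒴 (H₁ B)‖ ≤ B₁p * ‖πℬ B‖)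
    (hΦp : ∀ z ∈ ball (0 : Fin n → ℂ) rΦ, ‖πℬ (Φ z)‖ ≤ bp) (hbp : 0 ≤ bp)
    -- weight read-outs with PINNED letter ∕ curl constants (S69 (B)'s output shape, DISPLAYED), lengths
    (ℓw : 𝔭 → List (𝒴 →L[ℂ] Matrix nM nM ℂ)) {κw κc : 𝔭 → ℝ} (hκw : ∀ p ∈ Pw, 0 ≤ κw p)
    (hκc : ∀ p ∈ Pw, 0 ≤ κc p)
    (hℓwπ : ∀ p ∈ Pw, ∀ ℓ ∈ ℓw p, ∀ Y, ‖ℓ Y‖ ≤ κw p * ‖π𝒴 Y‖)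
    (hcurlπ : ∀ p ∈ Pw, ∀ Y, ‖((ℓw p).map fun ℓ => ℓ Y).sum‖ ≤ κc p * ‖π𝒴 Y‖)
    {mw : ℕ} (hlenw : ∀ p ∈ Pw, (ℓw p).length ≤ mw)
    -- the real structure (chain (A)) with SKEW weight read-outs (chain (E))
    (𝓡𝒴 : AddSubgroup 𝒴) (h𝓡𝒴 : IsClosed (𝓡𝒴 : Set 𝒴)) (𝓡𝒵 : AddSubgroup 𝒵) (𝓡𝒴' : AddSubgroup 𝒴')
    (𝓡𝒳 : AddSubgroup 𝒳) (h𝓡𝒳 : IsClosed (𝓡𝒳 : Set 𝒳)) (𝓡ℬ : AddSubgroup ℬ)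
    (h𝒢r : ∀ f ∈ 𝓡𝒵, 𝒢 f ∈ 𝓡𝒴) (hWr : ∀ Y ∈ 𝓡𝒴, W𝒱 Y ∈ 𝓡𝒵) (hιr : ∀ Y ∈ 𝓡𝒴, ι Y ∈ 𝓡𝒴')
    (hHr : ∀ X ∈ 𝓡𝒳, H X ∈ 𝓡𝒴) (hCr : ∀ Z ∈ 𝓡𝒴', C Z ∈ 𝓡𝒳) (hH₁r : ∀ B ∈ 𝓡ℬ, H₁ B ∈ 𝓡𝒴)
    (hΦr : ∀ y : Fin n → ℝ, ‖y‖ ≤ S → Φ (cplx y) ∈ 𝓡ℬ)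
    (hskew : ∀ p ∈ Pw, ∀ ℓ ∈ ℓw p, ∀ Y ∈ 𝓡𝒴, ℓ Y ∈ skewAdjoint (Matrix nM nM ℂ))
    -- the frozen background plaquettes (N-ne7cp1-g31-2)
    (Bp : 𝔭 → Matrix nM nM ℂ) {d : 𝔭 → ℝ} (hBu : ∀ p ∈ Pw, Bp p ∈ unitary (Matrix nM nM ℂ))
    (hBd : ∀ p ∈ Pw, ‖Bp p - 1‖ ≤ d p)
    -- the budget, SECOND ORDER in the window, in `z_pin` (S85)
    {β Hbar : ℝ}
    (hsum : ∑ p ∈ Pw, |β| * (d p + 2 * (κc p * (B₁p * bp / ((1 - qW) * (1 - LC * cι * BH))) +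
        expTail₂ (mw * (κw p * (B₁p * bp / ((1 - qW) * (1 - LC * cι * BH)))))) / (rΦ / S)) *
      (2 * (κc p * (B₁p * bp / ((1 - qW) * (1 - LC * cι * BH))) +
        expTail₂ (mw * (κw p * (B₁p * bp / ((1 - qW) * (1 - LC * cι * BH)))))) / (rΦ / S)) ≤ Hbar) :
    ∀ x ∈ W, ∀ c : ℝ, 1 / 2 ≤ c → c ≤ 1 →
      (fun y => ∑ p ∈ Pw, β * (1 - (Matrix.trace (Bp p * holOf (ℓw p) (fun y => landauExp C ι H
        (4 * C₂ * (ε₄ + B₀ * b) ^ 2) (solAt 𝒢 0 W𝒱 ε₄ (0 : 𝒵) (H₁ (Φ (cplx y))) + H₁ (Φ (cplx y)))) y)).re /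
          Fintype.card nM)) (c • x) ≤
      (fun y => ∑ p ∈ Pw, β * (1 - (Matrix.trace (Bp p * holOf (ℓw p) (fun y => landauExp C ι H
        (4 * C₂ * (ε₄ + B₀ * b) ^ 2) (solAt 𝒢 0 W𝒱 ε₄ (0 : 𝒵) (H₁ (Φ (cplx y))) + H₁ (Φ (cplx y)))) y)).re /
          Fintype.card nM)) x +
        (1 - c) * (3 * Hbar) := by
  set zpin : ℝ := B₁p * bp / ((1 - qW) * (1 - LC * cι * BH)) with hzpin
  have hk1 : 0 < 1 - LC * cι * BH := by linarith
  have hs1 : 0 < 1 - qW := by linarith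
  have hz : 0 ≤ zpin := div_nonneg (mul_nonneg hB₁p hbp) (mul_pos hs1 hk1).le
  -- the pinned size of the field on the complex chart ray (leaf-07's S70 (iv))
  have hZπ : ∀ x ∈ W, ∀ σ ∈ ball (0 : ℂ) (rΦ / S),
      ‖π𝒴 (landauExp C ι H (4 * C₂ * (ε₄ + B₀ * b) ^ 2)
        (solAt 𝒢 0 W𝒱 ε₄ (0 : 𝒵) (H₁ (Φ (σ • cplx x))) + H₁ (Φ (σ • cplx x))))‖ ≤ zpin := fun x hx σ hσ =>
    (norm_sub_landauField_chart_le π𝒴 π𝒴' π𝒳 πℬ h𝒢 hW hB₀ hC₄ hε₄ hdom hself hcontr hH₁ hΦ0 hΦ hC₂ hCq hCd hι hH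
      hq hRC hGWp hqW hCp hιp hHp hLC hcι hBH hk hB₁p hH₁p hΦp
      (smul_cplx_mem_ball hS (mem_closedBall_zero_iff.1 (hWS hx)) hσ)).2
  refine hE_landau_wilsonSquares_of_discBounds_schwarz hS hWS h𝒢 hW hB₀ hC₄ hε₄ hdom hself hcontr H₁ hH₁ hΦd hΦ0
    hΦ h2S hC₂ hCq hCd ι hι H hH hq hRC ℓw hlenw (a := fun p => κw p * zpin) (s₁ := fun p => κc p * zpin)
    (fun p hp => mul_nonneg (hκw p hp) hz) (fun x hx σ hσ p hp ℓ hℓ => ?_) (fun x hx σ hσ p hp => ?_)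
    𝓡𝒴 h𝓡𝒴 𝓡𝒵 𝓡𝒴' 𝓡𝒳 h𝓡𝒳 𝓡ℬ h𝒢r hWr hιr hHr hCr hH₁r hΦr hskew Bp hBu hBd (by simpa [hzpin] using hsum)
  · exact (hℓwπ p hp ℓ hℓ _).trans (mul_le_mul_of_nonneg_left (hZπ x hx σ hσ) (hκw p hp))
  · exact (hcurlπ p hp _).trans (mul_le_mul_of_nonneg_left (hZπ x hx σ hσ) (hκc p hp))

end ChartRay

end Summit.QuantumFields.BalabanUV.T4Continuum.ShellMeasureLandauWilsonSquaresSchwarz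

end
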